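import Summits.NavierStokesRegularity.NavierStokesRegularity.Theorems.LerayQuarterDissipationFiniteDissipationLiouvilleEnergyTraceDatum
import Summits.NavierStokesRegularity.NavierStokesRegularity.Theorems.LerayQuarterDissipationFiniteDissipationLiouvilleTraceWeighted
import HarnessLib

/-!
# Crux `FiniteDissipationLiouville` (stmt-NavierStokesRegularity-22144): the final datum of the
# critical element SATURATES the rate `‖x‖⁻¹` POINTWISE, at the apex and at infinity

Theorems file of route `LerayQuarterDissipation` (lead prover ns-lqd-lead g9; `--supports` the
crux, line `birth`). Navier–Stokes regularity is NOT proved by anything here; no summit is.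

Lead g6 (`…TraceWeighted`) proved the weighted floors of the TRACE: for a singular member of
`𝒟_{C,K}`, at every scale some test field `ψ` supported in `B(0,ρ)` (resp. in `{‖x‖ > R}`) has
`θ ∫‖ψ‖/‖x‖ < |T(ψ)|`. Lead g9 (`…EnergyTraceDatum`) identified the trace of the critical element
with the `C¹` profile `u₀` for EVERY test field. Together, by the elementary
`abs_integral_inner_le_of_weighted_bound` (`‖x‖‖u₀(x)‖ ≤ θ'` on the support of `ψ` forces
`|∫⟪u₀, ψ⟫| ≤ θ' ∫‖ψ‖/‖x‖`):

* `exists_norm_mul_norm_gt_near_apex` / `exists_norm_mul_norm_gt_farField` — the weighted floor at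
  scale `ρ` (resp. `R`) forces a point `x` with `‖x‖ < ρ` (resp. `‖x‖ > R`) and
  `‖x‖ ‖u₀(x)‖ > θ/2`.
* `finalDatum_saturation_of_minimal` — **for the CRITICAL ELEMENT: `θ < ‖x‖ ‖u₀(x)‖ ≤ A` along
  sequences `x → 0` AND `‖x‖ → ∞`** (`θ = θ(C,K_c) > 0`; the upper bound is the envelope). The final
  datum blows up at the apex at EXACTLY the self-similar rate `‖x‖⁻¹` — not slower (e.g. not
  `‖x‖⁻¹/log`) — and decays at infinity no faster than `‖x‖⁻¹` along a sequence; in particular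
  `u₀ ∉ L³` near the apex and `u₀` is not `o(‖x‖⁻¹)` at infinity, the two borderlines of the
  classical Liouville theorems for steady / self-similar profiles (Tsai 1998; Nadirashvili,
  Chae–Wolf for `o(‖x‖⁻¹)` decay).

Portrait facts (constants by compactness); no scenario removed; no summit proved.

References: Koch–Nadirashvili–Seregin–Šverák 2009, §4; Tsai, ARMA 143 (1998); Bradshaw–Tsai 2017
(DSS data `a(x̂)/|x|`).
-/

noncomputable section

-- the summit and its single sub-problem share the name (CONVENTIONS §1), as in every Theorems file
set_option linter.dupNamespace false

namespace Summit.NavierStokesRegularity.NavierStokesRegularity.Theorems.FiniteDissipationLiouville.FinalDatumSaturation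

open MeasureTheory Set Filter Topology Metric Function TopologicalSpace
open Literature.Analysis Literature.Analysis.FluidPDE
open Summit.NavierStokesRegularity.NavierStokesRegularity.Theorems.FiniteDissipationLiouville
open Summit.NavierStokesRegularity.NavierStokesRegularity.Theorems.FiniteDissipationLiouville.Birth.Apex
open Summit.NavierStokesRegularity.NavierStokesRegularity.Theorems
open scoped ENNReal NNReal RealInnerProductSpace

/-! ### The weighted pairing bound -/

/-- **`ψ ↦ ∫ ‖ψ‖/‖x‖` is finite for a test field** (`‖x‖⁻¹ ∈ L¹_loc(ℝ³)`), and the pairing of a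
measurable field `u₀` with `‖x‖ ‖u₀(x)‖ ≤ θ'` on the support of `ψ` obeys
`|∫⟪u₀, ψ⟫| ≤ θ' ∫ ‖ψ‖/‖x‖` (with integrability of the pairing). -/
theorem abs_integral_inner_le_of_weighted_bound
    {u₀ ψ : EuclideanSpace ℝ (Fin 3) → EuclideanSpace ℝ (Fin 3)} {θ' : ℝ}
    (hu₀m : AEStronglyMeasurable u₀ (volume : Measure (EuclideanSpace ℝ (Fin 3))))
    (hψ : FunctionSpaces.IsTestFunctionOn (⊤ : Opens (EuclideanSpace ℝ (Fin 3))) ψ)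
    (hbd : ∀ x, ψ x ≠ 0 → ‖x‖ * ‖u₀ x‖ ≤ θ') :
    Integrable (fun x => ‖ψ x‖ / ‖x‖) (volume : Measure (EuclideanSpace ℝ (Fin 3))) ∧
    Integrable (fun x => ⟪u₀ x, ψ x⟫) (volume : Measure (EuclideanSpace ℝ (Fin 3))) ∧
      |∫ x, ⟪u₀ x, ψ x⟫| ≤ θ' * ∫ x, ‖ψ x‖ / ‖x‖ := by
  have hcψ : Continuous ψ := hψ.contDiff.continuous
  have hψcs : HasCompactSupport ψ := hψ.hasCompactSupport
  obtain ⟨Kψ, hKψ⟩ := hcψ.bounded_above_of_compact_support hψcs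
  have hK0 : 0 ≤ Kψ := (norm_nonneg _).trans (hKψ 0)
  obtain ⟨R, hR0, hR⟩ := hψcs.isCompact.isBounded.subset_ball_lt 0 (0 : EuclideanSpace ℝ (Fin 3))
  have hsupp : ∀ x, ψ x ≠ 0 → x ∈ ball (0 : EuclideanSpace ℝ (Fin 3)) R := fun x hx =>
    hR (subset_tsupport _ (mem_support.2 hx))
  -- the weight `‖ψ‖/‖x‖` is integrable: dominated by `Kψ ‖x‖⁻¹` on the ball
  have hdom : Integrable (fun x : EuclideanSpace ℝ (Fin 3) =>
      Kψ * (ball (0 : EuclideanSpace ℝ (Fin 3)) R).indicator (fun x => ‖x‖ ^ (-(1 : ℝ))) x) := by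
    refine Integrable.const_mul ?_ Kψ
    exact ((NewtonPotentialHolder.integrableOn_ball_norm_rpow_neg (by norm_num : (1 : ℝ) < 3) R)).integrable_indicator
      measurableSet_ball
  have hwm : AEStronglyMeasurable (fun x : EuclideanSpace ℝ (Fin 3) => ‖ψ x‖ / ‖x‖)
      (volume : Measure (EuclideanSpace ℝ (Fin 3))) :=
    (hcψ.norm.measurable.div continuous_norm.measurable).aestronglyMeasurable
  have hw : Integrable (fun x => ‖ψ x‖ / ‖x‖) (volume : Measure (EuclideanSpace ℝ (Fin 3))) := by
    refine hdom.mono' hwm (Eventually.of_forall fun x => ?_)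
    rw [Real.norm_eq_abs, abs_of_nonneg (div_nonneg (norm_nonneg _) (norm_nonneg _))]
    by_cases hx : ψ x = 0
    · rw [hx, norm_zero, zero_div]
      exact mul_nonneg hK0 (indicator_nonneg (fun y _ => Real.rpow_nonneg (norm_nonneg _) _) _)
    · have hxb := hsupp x hx
      rw [indicator_of_mem hxb, Real.rpow_neg (norm_nonneg _), Real.rpow_one, div_eq_mul_inv]
      exact mul_le_mul_of_nonneg_right (hKψ x) (inv_nonneg.2 (norm_nonneg _))
  -- the pairing is dominated by `θ' ‖ψ‖/‖x‖` off the (null) origin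
  have hne : ∀ᵐ x ∂(volume : Measure (EuclideanSpace ℝ (Fin 3))), x ≠ 0 := by
    rw [ae_iff]
    have e : {x : EuclideanSpace ℝ (Fin 3) | ¬ x ≠ 0} = {0} := by ext x; simp
    rw [e]; exact measure_singleton 0
  have hpt : ∀ x : EuclideanSpace ℝ (Fin 3), x ≠ 0 → ‖⟪u₀ x, ψ x⟫‖ ≤ θ' * (‖ψ x‖ / ‖x‖) := by
    intro x hx0
    rw [Real.norm_eq_abs]
    by_cases hx : ψ x = 0
    · rw [hx, inner_zero_right, abs_zero, norm_zero, zero_div, mul_zero]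
    · have hxpos : 0 < ‖x‖ := norm_pos_iff.2 hx0
      calc |⟪u₀ x, ψ x⟫| ≤ ‖u₀ x‖ * ‖ψ x‖ := abs_real_inner_le_norm _ _
        _ = (‖x‖ * ‖u₀ x‖) * (‖ψ x‖ / ‖x‖) := by field_simp
        _ ≤ θ' * (‖ψ x‖ / ‖x‖) :=
            mul_le_mul_of_nonneg_right (hbd x hx) (div_nonneg (norm_nonneg _) hxpos.le)
  have hae : ∀ᵐ x ∂(volume : Measure (EuclideanSpace ℝ (Fin 3))),
      ‖⟪u₀ x, ψ x⟫‖ ≤ θ' * (‖ψ x‖ / ‖x‖) := by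
    filter_upwards [hne] with x hx
    exact hpt x hx
  have hint : Integrable (fun x => ⟪u₀ x, ψ x⟫) (volume : Measure (EuclideanSpace ℝ (Fin 3))) :=
    (hw.const_mul θ').mono' (hu₀m.inner hcψ.aestronglyMeasurable) hae
  refine ⟨hw, hint, ?_⟩
  rw [← Real.norm_eq_abs, ← integral_const_mul]
  exact norm_integral_le_of_norm_le (hw.const_mul θ') hae

/-! ### Pointwise saturation from the weighted floors -/

/-- **The weighted apex floor forces a point of `B(0,ρ)` where `‖x‖ ‖u₀(x)‖ > θ/2`.** If some test
field `ψ` supported in `B(0, ρ)` has `θ ∫‖ψ‖/‖x‖ < |∫⟪u₀, ψ⟫|` with `θ > 0`, then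
`‖x‖ ‖u₀(x)‖ > θ/2` for some `x` with `0 < ‖x‖ < ρ`. -/
theorem exists_norm_mul_norm_gt_near_apex
    {u₀ : EuclideanSpace ℝ (Fin 3) → EuclideanSpace ℝ (Fin 3)}
    (hu₀m : AEStronglyMeasurable u₀ (volume : Measure (EuclideanSpace ℝ (Fin 3)))) {θ ρ : ℝ}
    (hθ : 0 < θ)
    (hfloor : ∃ (ψ : EuclideanSpace ℝ (Fin 3) → EuclideanSpace ℝ (Fin 3)),
      FunctionSpaces.IsTestFunctionOn (⊤ : Opens (EuclideanSpace ℝ (Fin 3))) ψ ∧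
      (∀ x, ψ x ≠ 0 → ‖x‖ < ρ) ∧ θ * (∫ x, ‖ψ x‖ / ‖x‖) < |∫ x, ⟪u₀ x, ψ x⟫|) :
    ∃ x : EuclideanSpace ℝ (Fin 3), 0 < ‖x‖ ∧ ‖x‖ < ρ ∧ θ / 2 < ‖x‖ * ‖u₀ x‖ := by
  obtain ⟨ψ, hψ, hsupp, hlt⟩ := hfloor
  by_contra hcon
  push Not at hcon
  have hbd : ∀ x, ψ x ≠ 0 → ‖x‖ * ‖u₀ x‖ ≤ θ / 2 := by
    intro x hx
    by_cases hx0 : x = 0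
    · rw [hx0, norm_zero, zero_mul]; exact by positivity
    · exact hcon x (norm_pos_iff.2 hx0) (hsupp x hx)
  obtain ⟨hw, -, hle⟩ := abs_integral_inner_le_of_weighted_bound hu₀m hψ hbd
  have hI0 : 0 ≤ ∫ x, ‖ψ x‖ / ‖x‖ := integral_nonneg fun x => div_nonneg (norm_nonneg _) (norm_nonneg _)
  have h := hlt.trans_le hle
  nlinarith

/-- **The weighted far-field floor forces a point with `‖x‖ > R` and `‖x‖ ‖u₀(x)‖ > θ/2`.** -/
theorem exists_norm_mul_norm_gt_farField
    {u₀ : EuclideanSpace ℝ (Fin 3) → EuclideanSpace ℝ (Fin 3)}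
    (hu₀m : AEStronglyMeasurable u₀ (volume : Measure (EuclideanSpace ℝ (Fin 3)))) {θ R : ℝ}
    (hθ : 0 < θ)
    (hfloor : ∃ (ψ : EuclideanSpace ℝ (Fin 3) → EuclideanSpace ℝ (Fin 3)),
      FunctionSpaces.IsTestFunctionOn (⊤ : Opens (EuclideanSpace ℝ (Fin 3))) ψ ∧
      (∀ x, ψ x ≠ 0 → R < ‖x‖) ∧ θ * (∫ x, ‖ψ x‖ / ‖x‖) < |∫ x, ⟪u₀ x, ψ x⟫|) :
    ∃ x : EuclideanSpace ℝ (Fin 3), R < ‖x‖ ∧ θ / 2 < ‖x‖ * ‖u₀ x‖ := by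
  obtain ⟨ψ, hψ, hsupp, hlt⟩ := hfloor
  by_contra hcon
  push Not at hcon
  have hbd : ∀ x, ψ x ≠ 0 → ‖x‖ * ‖u₀ x‖ ≤ θ / 2 := fun x hx => hcon x (hsupp x hx)
  obtain ⟨hw, -, hle⟩ := abs_integral_inner_le_of_weighted_bound hu₀m hψ hbd
  have hI0 : 0 ≤ ∫ x, ‖ψ x‖ / ‖x‖ := integral_nonneg fun x => div_nonneg (norm_nonneg _) (norm_nonneg _)
  have h := hlt.trans_le hle
  nlinarith

/-! ### Packaged for the critical element -/

/-- **THE FINAL DATUM OF THE CRITICAL ELEMENT SATURATES `‖x‖⁻¹` POINTWISE AT BOTH ENDS.** For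
`K_c` minimal and `w ∈ 𝒟_{C,K_c}` singular there are the envelope constant `A`, a floor
`θ = θ(C,K_c) > 0` and the final datum `u₀` (the trace of `w` for every test field, with
`‖u₀(x)‖ ≤ A/‖x‖`) such that for every `ρ > 0` some `x` with `0 < ‖x‖ < ρ` and for every `R > 0`
some `x` with `‖x‖ > R` satisfy `θ < ‖x‖ ‖u₀(x)‖`: along sequences `x → 0` and `‖x‖ → ∞` the
profile is pinned between `θ/‖x‖` and `A/‖x‖`. [cite: KochNadirashviliSereginSverak2009, §4 (arXiv:0709.3599 p. 8)] -/
theorem finalDatum_saturation_of_minimal {C Kc : ℝ}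
    (hmin : ∀ K' : ℝ, K' < Kc → ∀ v : ℝ → EuclideanSpace ℝ (Fin 3) → EuclideanSpace ℝ (Fin 3),
      IsTypeIAncientMild C v →
      (∀ s : ℝ, s < 0 → ∫⁻ x, ‖fderiv ℝ (v s) x‖ₑ ^ 2 ≤ ENNReal.ofReal (K' / Real.sqrt (-s))) →
      ¬ (∀ r > 0, ∀ M : ℝ, ∃ t ∈ Set.Ioo (-(r ^ 2)) (0 : ℝ),
        ∃ x ∈ Metric.ball (0 : EuclideanSpace ℝ (Fin 3)) r, M < ‖v t x‖))
    {w : ℝ → EuclideanSpace ℝ (Fin 3) → EuclideanSpace ℝ (Fin 3)} (hw : IsTypeIAncientMild C w)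
    (hDw : ∀ s : ℝ, s < 0 → ∫⁻ x, ‖fderiv ℝ (w s) x‖ₑ ^ 2 ≤ ENNReal.ofReal (Kc / Real.sqrt (-s)))
    (hsw : ∀ r > 0, ∀ M : ℝ, ∃ t ∈ Set.Ioo (-(r ^ 2)) (0 : ℝ),
      ∃ x ∈ Metric.ball (0 : EuclideanSpace ℝ (Fin 3)) r, M < ‖w t x‖) :
    ∃ (A θ : ℝ) (u₀ : EuclideanSpace ℝ (Fin 3) → EuclideanSpace ℝ (Fin 3)), 0 ≤ A ∧ 0 < θ ∧
      (∀ x : EuclideanSpace ℝ (Fin 3), x ≠ 0 → ‖u₀ x‖ ≤ A / ‖x‖) ∧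
      (∀ ψ : EuclideanSpace ℝ (Fin 3) → EuclideanSpace ℝ (Fin 3),
        FunctionSpaces.IsTestFunctionOn (⊤ : Opens (EuclideanSpace ℝ (Fin 3))) ψ →
        Tendsto (fun t => ∫ x, ⟪w t x, ψ x⟫) (𝓝[<] 0) (𝓝 (∫ x, ⟪u₀ x, ψ x⟫))) ∧
      (∀ ρ > 0, ∃ x : EuclideanSpace ℝ (Fin 3), 0 < ‖x‖ ∧ ‖x‖ < ρ ∧ θ < ‖x‖ * ‖u₀ x‖) ∧
      (∀ R > 0, ∃ x : EuclideanSpace ℝ (Fin 3), R < ‖x‖ ∧ θ < ‖x‖ * ‖u₀ x‖) := by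
  obtain ⟨A, L₀, M, u₀, hA0, -, -, -, hrate, henv, -, hener, -⟩ :=
    EnergyRemainder.finalDatum_profile_energy_of_minimal hmin hw hDw hsw
  have hu₀m := EnergyRemainder.aestronglyMeasurable_finalDatum hw hrate
  have htrace : ∀ ψ : EuclideanSpace ℝ (Fin 3) → EuclideanSpace ℝ (Fin 3),
      FunctionSpaces.IsTestFunctionOn (⊤ : Opens (EuclideanSpace ℝ (Fin 3))) ψ →
      Tendsto (fun t => ∫ x, ⟪w t x, ψ x⟫) (𝓝[<] 0) (𝓝 (∫ x, ⟪u₀ x, ψ x⟫)) :=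
    fun ψ hψ => EnergyTrace.tendsto_pairing_of_energy hw hu₀m hener hψ
  obtain ⟨θ₁, hθ₁, h₁⟩ := trace_weighted_apex_floor_of_singular C Kc
  obtain ⟨θ₂, hθ₂, h₂⟩ := trace_weighted_farField_floor_of_singular C Kc
  refine ⟨A, min θ₁ θ₂ / 2, u₀, hA0, by positivity, henv, htrace, fun ρ hρ => ?_, fun R hR => ?_⟩
  · obtain ⟨ψ, T, hψ, hsupp, hT, hlt⟩ := h₁ w hw hDw hsw ρ hρ
    have hTeq : T = ∫ x, ⟪u₀ x, ψ x⟫ := tendsto_nhds_unique hT (htrace ψ hψ)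
    rw [hTeq] at hlt
    obtain ⟨x, hx0, hxρ, hx⟩ := exists_norm_mul_norm_gt_near_apex hu₀m hθ₁ ⟨ψ, hψ, hsupp, hlt⟩
    refine ⟨x, hx0, hxρ, lt_of_le_of_lt ?_ hx⟩
    exact div_le_div_of_nonneg_right (min_le_left _ _) (by norm_num)
  · obtain ⟨ψ, T, hψ, hsupp, hT, hlt⟩ := h₂ w hw hDw hsw R hR
    have hTeq : T = ∫ x, ⟪u₀ x, ψ x⟫ := tendsto_nhds_unique hT (htrace ψ hψ)
    rw [hTeq] at hlt
    obtain ⟨x, hxR, hx⟩ := exists_norm_mul_norm_gt_farField hu₀m hθ₂ ⟨ψ, hψ, hsupp, hlt⟩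
    refine ⟨x, hxR, lt_of_le_of_lt ?_ hx⟩
    exact div_le_div_of_nonneg_right (min_le_right _ _) (by norm_num)

end Summit.NavierStokesRegularity.NavierStokesRegularity.Theorems.FiniteDissipationLiouville.FinalDatumSaturation

end
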